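import Literature.NumberTheory.Sieve.CFSemigroupNLI
import HarnessLib

/-!
# The consequence of (NLI) used by the Dolgopyat argument (Magee–Oh–Winter Lemma 25 / Naud Prop. 5.5)

Support file (all results proved) for the programme of proving [MageeOhWinter2019, Thm. 4 (2)] for the
continued-fractions semigroup `Γ_A`. [MageeOhWinter2019, Lemma 25] (= Naud, Prop. 5.5): if `τ` has (NLI)
then there are `m, m', N₀ > 0` and, for every `N > N₀`, two inverse branches `α₁^N, α₂^N` of `T^N` with
`m ≤ |d/du [τ^N ∘ α₁^N - τ^N ∘ α₂^N](u)| ≤ m'` for all `u ∈ I` ("the lower bound is the harder one").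

For the CF coding (`T|_{I_a} = g_a⁻¹`, `g_a u = 1/(u+a)`, `τ = log|T'|`, `τ(g_a x) = 2 log (x + a)`,
`CFSemigroupNLI.lean`) we take the branches `α₁^N = g_a^N`, `α₂^N = g_b^N` of two letters `a ≠ b` (for the
pair system of §2.1 (II) use even `N`). Then `τ^N(α^N u) = Σ_{i=1}^{N} τ(g^i u)` (`cfBirkhoff`), and the
telescoping closed form of `CFSemigroupNLI.lean` gives
`d/du τ^N(g_a^N u) = 2/(u - ω_a^*) - 2 (g_a^N)'(u)/(g_a^N u - ω_a^*)` with `|(g_a^N)'| ≤ 2 (1/2)^N`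
(`hasDerivWithinAt_cfBirkhoff`, `abs_cfBrD_le`), so the derivative of the difference converges uniformly to
`∂_u φ_{ξ,η} = 2/(u - ω_a^*) - 2/(u - ω_b^*)`, which vanishes nowhere on `[0,1]` (NLI, `cfTemporal_deriv_ne_zero`);
compactness gives the two-sided bounds (`cf_nli_consequence`).

## References

* [MageeOhWinter2019] M. Magee, H. Oh, D. Winter, J. reine angew. Math. 753 (2019) 89–135, §4.4 Lemma 25
  (after F. Naud, Ann. Sci. ÉNS 38 (2005), Prop. 5.5).
-/

noncomputable section

open Set Filter
open scoped Topology

namespace Literature.NumberTheory.Sieve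

/-! ### Derivatives of the branch `g_a` and of its iterates -/

section BranchDeriv

variable {a : ℕ} (ha : 1 ≤ a)
include ha

/-- `g_a'(x) = -g_a(x)²` for `x ≥ 0`. [folklore] -/
theorem hasDerivAt_cfBr {x : ℝ} (hx : 0 ≤ x) : HasDerivAt (cfBr a) (-(cfBr a x) ^ 2) x := by
  have h1 : (1 : ℝ) ≤ a := by exact_mod_cast ha
  have hxa : x + a ≠ 0 := by linarith
  have h := ((hasDerivAt_id x).add_const (a : ℝ)).inv hxa
  have e : cfBr a = fun y : ℝ => (y + (a : ℝ))⁻¹ := funext fun y => by simp [cfBr]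
  rw [e]
  refine h.congr_deriv ?_
  simp only [id_eq]
  field_simp

omit ha in
/-- The derivative of the `n`-th iterate of `g_a` (chain rule): `D_{n+1}(u) = -(g_a^{n+1} u)² D_n(u)`. [folklore] -/
def cfBrD (a : ℕ) : ℕ → ℝ → ℝ
  | 0, _ => 1
  | n + 1, u => -((cfBr a)^[n + 1] u) ^ 2 * cfBrD a n u

/-- **`(g_a^n)'(u) = D_n(u)`** on `[0,1]`. [folklore] -/
theorem hasDerivAt_iterate_cfBr {u : ℝ} (hu : u ∈ Icc (0 : ℝ) 1) (n : ℕ) :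
    HasDerivAt ((cfBr a)^[n]) (cfBrD a n u) u := by
  induction n with
  | zero => simpa [cfBrD] using hasDerivAt_id u
  | succ n ih =>
    have hmem := iterate_cfBr_mem ha hu n
    have hg := hasDerivAt_cfBr ha hmem.1
    have h := hg.comp u ih
    rw [show (cfBr a)^[n + 1] = cfBr a ∘ (cfBr a)^[n] from Function.iterate_succ' _ _]
    refine h.congr_deriv ?_
    simp only [cfBrD, Function.iterate_succ_apply']

/-- **Geometric decay of the branch derivatives:** `|D_n(u)| ≤ 2 (1/2)^n` on `[0,1]` (two-step contraction
`g x · g (g x) ≤ 1/2`). [cite: MageeOhWinter2019, §2.1 (Prop. 5)] -/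
theorem abs_cfBrD_le {u : ℝ} (hu : u ∈ Icc (0 : ℝ) 1) (n : ℕ) : |cfBrD a n u| ≤ 2 * (1 / 2) ^ n := by
  have hP : ∀ n, |cfBrD a n u| ≤ 2 * (1 / 2) ^ n ∧ |cfBrD a (n + 1) u| ≤ 2 * (1 / 2) ^ (n + 1) := by
    intro n
    induction n with
    | zero =>
      refine ⟨by simp [cfBrD], ?_⟩
      simp only [cfBrD, Function.iterate_one, mul_one, abs_neg, abs_pow, zero_add, pow_one]
      have h0 := (cfBr_mem ha hu).1
      have h1 := (cfBr_mem ha hu).2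
      rw [abs_of_nonneg h0]
      nlinarith
    | succ n ih =>
      refine ⟨ih.2, ?_⟩
      -- `|D_{n+2}| = (g^{n+2} u)² (g^{n+1} u)² |D_n| ≤ (1/4) · 2 (1/2)^n`
      have hx := iterate_cfBr_mem ha hu n
      have hprod := cfBr_mul_cfBr_le ha hx.1
      have e1 : (cfBr a)^[n + 1] u = cfBr a ((cfBr a)^[n] u) := Function.iterate_succ_apply' _ _ _
      have e2 : (cfBr a)^[n + 1 + 1] u = cfBr a (cfBr a ((cfBr a)^[n] u)) := by
        rw [Function.iterate_succ_apply', e1]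
      have hy0 : 0 ≤ cfBr a ((cfBr a)^[n] u) := (cfBr_mem ha hx).1
      have hz0 : 0 ≤ cfBr a (cfBr a ((cfBr a)^[n] u)) := (cfBr_mem ha (cfBr_mem ha hx)).1
      have hsq : ((cfBr a)^[n + 1 + 1] u) ^ 2 * ((cfBr a)^[n + 1] u) ^ 2 ≤ 1 / 4 := by
        rw [e1, e2]
        have : (cfBr a (cfBr a ((cfBr a)^[n] u))) ^ 2 * (cfBr a ((cfBr a)^[n] u)) ^ 2 =
            (cfBr a ((cfBr a)^[n] u) * cfBr a (cfBr a ((cfBr a)^[n] u))) ^ 2 := by ring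
        rw [this]
        have hp0 : 0 ≤ cfBr a ((cfBr a)^[n] u) * cfBr a (cfBr a ((cfBr a)^[n] u)) := mul_nonneg hy0 hz0
        nlinarith
      have e3 : cfBrD a (n + 1 + 1) u = -((cfBr a)^[n + 1 + 1] u) ^ 2 * (-((cfBr a)^[n + 1] u) ^ 2 * cfBrD a n u) := rfl
      rw [e3]
      have habs : |-((cfBr a)^[n + 1 + 1] u) ^ 2 * (-((cfBr a)^[n + 1] u) ^ 2 * cfBrD a n u)| =
          ((cfBr a)^[n + 1 + 1] u) ^ 2 * ((cfBr a)^[n + 1] u) ^ 2 * |cfBrD a n u| := by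
        rw [abs_mul, abs_mul, abs_neg, abs_neg, abs_pow, abs_pow, sq_abs, sq_abs]; ring
      rw [habs]
      calc ((cfBr a)^[n + 1 + 1] u) ^ 2 * ((cfBr a)^[n + 1] u) ^ 2 * |cfBrD a n u| ≤ 1 / 4 * (2 * (1 / 2) ^ n) :=
            mul_le_mul hsq ih.1 (abs_nonneg _) (by norm_num)
        _ = 2 * (1 / 2) ^ (n + 1 + 1) := by ring
  exact (hP n).1

end BranchDeriv

/-! ### The Birkhoff sums `τ^N ∘ g^N` and their derivatives -/

/-- The Birkhoff sum of `τ` along the branch `g_a^n`: `τ^n(g_a^n u) = Σ_{i<n} τ(g_a^{i+1} u)`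
(`T^j (g_a^n u) = g_a^{n-j} u`). [cite: MageeOhWinter2019, §4.4] -/
def cfBirkhoff (a n : ℕ) (u : ℝ) : ℝ := ∑ i ∈ Finset.range n, cfTauFn ((cfBr a)^[i + 1] u)

section Birkhoff

variable {a : ℕ} (ha : 1 ≤ a)
include ha

/-- **Closed form of the Birkhoff sums** (telescoping through the repelling fixed point `ω_a^*`):
`τ^n(g_a^n u) = 2 log(u - ω_a^*) - 2 log(g_a^n u - ω_a^*) + c_n` with `c_n` independent of `u`.
[cite: MageeOhWinter2019, §4.1 and Lemma 25] -/
theorem cfBirkhoff_eq {u : ℝ} (hu : u ∈ Icc (0 : ℝ) 1) (n : ℕ) :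
    cfBirkhoff a n u = 2 * (Real.log (u - cfOmegaStar a) - Real.log ((cfBr a)^[n] u - cfOmegaStar a)) -
      2 * (Real.log (0 - cfOmegaStar a) - Real.log ((cfBr a)^[n] 0 - cfOmegaStar a)) + cfBirkhoff a n 0 := by
  have h0 : (0 : ℝ) ∈ Icc (0 : ℝ) 1 := ⟨le_rfl, zero_le_one⟩
  have h := sum_range_cfDelta_summand ha hu h0 n
  rw [Finset.sum_sub_distrib] at h
  have e : ∑ i ∈ Finset.range n, cfTauFn ((cfBr a)^[i + 1] u) = cfBirkhoff a n u := rfl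
  have e0 : ∑ i ∈ Finset.range n, cfTauFn ((cfBr a)^[i + 1] 0) = cfBirkhoff a n 0 := rfl
  rw [e, e0] at h
  linarith

/-- **Derivative of the Birkhoff sums:** `d/du τ^n(g_a^n u) = 2/(u - ω_a^*) - 2 D_n(u)/(g_a^n u - ω_a^*)` within `[0,1]`.
[cite: MageeOhWinter2019, Lemma 25] -/
theorem hasDerivWithinAt_cfBirkhoff {u : ℝ} (hu : u ∈ Icc (0 : ℝ) 1) (n : ℕ) :
    HasDerivWithinAt (cfBirkhoff a n)
      (2 * (1 / (u - cfOmegaStar a) - cfBrD a n u / ((cfBr a)^[n] u - cfOmegaStar a))) (Icc (0 : ℝ) 1) u := by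
  have hω := cfOmegaStar_lt ha
  have hun := iterate_cfBr_mem ha hu n
  have hlog1 : HasDerivAt (fun u : ℝ => Real.log (u - cfOmegaStar a)) (1 / (u - cfOmegaStar a)) u := by
    have h := ((hasDerivAt_id u).sub_const (cfOmegaStar a)).log (by simp; linarith [hu.1])
    simpa using h
  have hlog2 : HasDerivAt (fun u : ℝ => Real.log ((cfBr a)^[n] u - cfOmegaStar a))
      (cfBrD a n u / ((cfBr a)^[n] u - cfOmegaStar a)) u := by
    have h := ((hasDerivAt_iterate_cfBr ha hu n).sub_const (cfOmegaStar a)).log (by linarith [hun.1])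
    simpa using h
  have hF : HasDerivAt (fun u : ℝ => 2 * (Real.log (u - cfOmegaStar a) - Real.log ((cfBr a)^[n] u - cfOmegaStar a)) -
      2 * (Real.log (0 - cfOmegaStar a) - Real.log ((cfBr a)^[n] 0 - cfOmegaStar a)) + cfBirkhoff a n 0)
      (2 * (1 / (u - cfOmegaStar a) - cfBrD a n u / ((cfBr a)^[n] u - cfOmegaStar a))) u := by
    have h := (((hlog1.sub hlog2).const_mul 2).sub_const
      (2 * (Real.log (0 - cfOmegaStar a) - Real.log ((cfBr a)^[n] 0 - cfOmegaStar a)))).add_const (cfBirkhoff a n 0)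
    exact h
  exact hF.hasDerivWithinAt.congr_of_mem (fun w hw => cfBirkhoff_eq ha hw n) hu

/-- The error term is small: `|2 D_n(u)/(g_a^n u - ω_a^*)| ≤ 4 (1/2)^n` (`g^n u - ω^* > 1`). [folklore] -/
theorem abs_error_le {u : ℝ} (hu : u ∈ Icc (0 : ℝ) 1) (n : ℕ) :
    |2 * (cfBrD a n u / ((cfBr a)^[n] u - cfOmegaStar a))| ≤ 4 * (1 / 2) ^ n := by
  have hω := cfOmegaStar_lt ha
  have hun := iterate_cfBr_mem ha hu n
  have hden : 1 < (cfBr a)^[n] u - cfOmegaStar a := by linarith [hun.1]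
  have hdenpos : 0 < (cfBr a)^[n] u - cfOmegaStar a := by linarith
  rw [abs_mul, abs_of_pos (by norm_num : (0:ℝ) < 2), abs_div, abs_of_pos (a := (cfBr a)^[n] u - cfOmegaStar a) hdenpos]
  have h1 : |cfBrD a n u| / ((cfBr a)^[n] u - cfOmegaStar a) ≤ |cfBrD a n u| := div_le_self (abs_nonneg _) hden.le
  linarith [abs_cfBrD_le ha hu n]

end Birkhoff

/-! ### The two-sided derivative bounds -/

section Main

variable {a b : ℕ} (ha : 1 ≤ a) (hb : 1 ≤ b)
include ha hb

/-- **The consequence of (NLI) [MageeOhWinter2019, Lemma 25] for the CF coding:** for letters `a ≠ b` there are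
`0 < m ≤ m'` and `N₀` such that for all `N ≥ N₀` and all `u ∈ [0,1]` the difference of Birkhoff sums along
the two branches `g_a^N`, `g_b^N` of `T^{-N}` has `u`-derivative `d` (within `[0,1]`) with `m ≤ |d| ≤ m'`.
[cite: MageeOhWinter2019, Lemma 25] -/
theorem cf_nli_consequence (hab : a ≠ b) :
    ∃ m m' : ℝ, 0 < m ∧ m ≤ m' ∧ ∃ N₀ : ℕ, ∀ N : ℕ, N₀ ≤ N → ∀ u ∈ Icc (0 : ℝ) 1,
      ∃ d : ℝ, HasDerivWithinAt (fun u => cfBirkhoff a N u - cfBirkhoff b N u) d (Icc (0 : ℝ) 1) u ∧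
        m ≤ |d| ∧ |d| ≤ m' := by
  have hωa := cfOmegaStar_lt ha
  have hωb := cfOmegaStar_lt hb
  -- the main term `ψ(u) = 2/(u - ω_a^*) - 2/(u - ω_b^*)` and its positive minimum modulus on `[0,1]`
  set ψ : ℝ → ℝ := fun u => 2 / (u - cfOmegaStar a) - 2 / (u - cfOmegaStar b) with hψ
  have hcont : ∀ c : ℝ, c < -1 → ContinuousOn (fun u : ℝ => 2 / (u - c)) (Icc (0 : ℝ) 1) := fun c hc =>
    continuousOn_const.div (continuousOn_id.sub continuousOn_const) fun u hu =>
      ne_of_gt (show (0 : ℝ) < id u - c by simp only [id_eq]; linarith [hu.1])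
  have hψcont : ContinuousOn ψ (Icc (0 : ℝ) 1) := (hcont _ hωa).sub (hcont _ hωb)
  obtain ⟨u₀, hu₀, hmin⟩ := isCompact_Icc.exists_isMinOn (nonempty_Icc.2 zero_le_one) hψcont.norm
  set m₀ : ℝ := |ψ u₀| with hm₀
  have hm₀pos : 0 < m₀ := abs_pos.2 (cfTemporal_deriv_ne_zero ha hb hab hu₀)
  have hm₀le : ∀ u ∈ Icc (0 : ℝ) 1, m₀ ≤ |ψ u| := fun u hu => by
    have := hmin hu; simpa [Real.norm_eq_abs] using this
  have hψle : ∀ u ∈ Icc (0 : ℝ) 1, |ψ u| ≤ 4 := fun u hu => by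
    have h1 : 0 < u - cfOmegaStar a := by linarith [hu.1]
    have h2 : 0 < u - cfOmegaStar b := by linarith [hu.1]
    have b1 : 2 / (u - cfOmegaStar a) ≤ 2 := by rw [div_le_iff₀ h1]; linarith [hu.1]
    have b2 : 2 / (u - cfOmegaStar b) ≤ 2 := by rw [div_le_iff₀ h2]; linarith [hu.1]
    have b1' : 0 ≤ 2 / (u - cfOmegaStar a) := by positivity
    have b2' : 0 ≤ 2 / (u - cfOmegaStar b) := by positivity
    rw [hψ, abs_le]; constructor <;> simp only <;> linarith
  -- `N₀` with `8 (1/2)^{N₀} ≤ m₀/2`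
  obtain ⟨N₀, hN₀⟩ := exists_pow_lt_of_lt_one (show 0 < m₀ / 16 by positivity) (by norm_num : (1 / 2 : ℝ) < 1)
  refine ⟨m₀ / 2, 4 + m₀, by positivity, by linarith, N₀, fun N hN u hu => ?_⟩
  have hpow : (1 / 2 : ℝ) ^ N ≤ (1 / 2) ^ N₀ := pow_le_pow_of_le_one (by norm_num) (by norm_num) hN
  have herr : 8 * (1 / 2 : ℝ) ^ N ≤ m₀ / 2 := by nlinarith
  set da := 2 * (1 / (u - cfOmegaStar a) - cfBrD a N u / ((cfBr a)^[N] u - cfOmegaStar a)) with hda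
  set db := 2 * (1 / (u - cfOmegaStar b) - cfBrD b N u / ((cfBr b)^[N] u - cfOmegaStar b)) with hdb
  refine ⟨da - db, (hasDerivWithinAt_cfBirkhoff ha hu N).sub (hasDerivWithinAt_cfBirkhoff hb hu N), ?_, ?_⟩
  · -- lower bound: `|da - db| ≥ |ψ u| - 8 (1/2)^N ≥ m₀/2`
    have e : da - db = ψ u - (2 * (cfBrD a N u / ((cfBr a)^[N] u - cfOmegaStar a)) -
        2 * (cfBrD b N u / ((cfBr b)^[N] u - cfOmegaStar b))) := by
      rw [hda, hdb, hψ]; ring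
    rw [e]
    have h1 := abs_error_le ha hu N
    have h2 := abs_error_le hb hu N
    have htri := abs_sub_abs_le_abs_sub (ψ u) (2 * (cfBrD a N u / ((cfBr a)^[N] u - cfOmegaStar a)) -
        2 * (cfBrD b N u / ((cfBr b)^[N] u - cfOmegaStar b)))
    have hE : |2 * (cfBrD a N u / ((cfBr a)^[N] u - cfOmegaStar a)) - 2 * (cfBrD b N u / ((cfBr b)^[N] u - cfOmegaStar b))|
        ≤ 8 * (1 / 2) ^ N := (abs_sub _ _).trans (by linarith)
    linarith [hm₀le u hu]
  · -- upper bound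
    have e : da - db = ψ u - (2 * (cfBrD a N u / ((cfBr a)^[N] u - cfOmegaStar a)) -
        2 * (cfBrD b N u / ((cfBr b)^[N] u - cfOmegaStar b))) := by
      rw [hda, hdb, hψ]; ring
    rw [e]
    have h1 := abs_error_le ha hu N
    have h2 := abs_error_le hb hu N
    have hE : |2 * (cfBrD a N u / ((cfBr a)^[N] u - cfOmegaStar a)) - 2 * (cfBrD b N u / ((cfBr b)^[N] u - cfOmegaStar b))|
        ≤ 8 * (1 / 2) ^ N := (abs_sub _ _).trans (by linarith)
    have := abs_sub (ψ u) (2 * (cfBrD a N u / ((cfBr a)^[N] u - cfOmegaStar a)) -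
        2 * (cfBrD b N u / ((cfBr b)^[N] u - cfOmegaStar b)))
    linarith [hψle u hu]

end Main

end Literature.NumberTheory.Sieve
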